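import Mathlib
import Summits.NavierStokesRegularity.NavierStokesRegularity.Theorems.SubOnsagerCeilingDefs
import HarnessLib

/-!
# One currency for the corners: tail ceiling ⇒ shell barrier ⇒ primary graded barrier
# (helper file for the crux `SubOnsagerCeiling.ForwardTailCeilingKP`, stmt-NavierStokesRegularity-27057, `--supports`)

The registered stubs `stub_primaryGradedLargeRatio` / `stub_primaryGradedSmallRatio` of the LEAD skeleton
`Cruxes/ForwardTailCeilingKP/Lines/kp_shell_barrier.lean` (v19) are stated in the currency `PrimaryGradedAt R ε₀ α`
(a grading of the modes with structural clauses + a ν-uniform weighted shell barrier `θ ∈ (1/2, 1]` of the level-0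
modes), while most landed corners are stated as `CeilingAt R ε₀ α` (tail sums) or `ShellBarrierAt R ε₀ α` (per-shell,
`θ > 1/2` unbounded above) and enter the composition through the by-pass `fwdCeilingKPAt_of_ceilingAt`.  This file
records that the three currencies agree on every table, so that every landed `CeilingAt` / `ShellBarrierAt` corner IS
a corner of the registered stubs themselves:

* `kpShellBarrierAt_of_ceilingAt` — `CeilingAt R ε₀ α → ShellBarrierAt R ε₀ α` (one-term window `N = n` of the tail
  sum; same `θ`, `D = C`); the converse `subOnsagerCeiling_ceilingAt_of_shellBarrierAt` is landed (geometric series);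
* `kpPrimaryGraded_of_shellBarrierAt` — `ShellBarrierAt R ε₀ α →` the body of `PrimaryGradedAt R ε₀ α` (verbatim,
  skeleton v6–v19) with the TRIVIAL grading `lev ≡ 0` (the structural clauses `GradedStruct α lev` are vacuous) and
  the exponent `min θ 1` (the weight `(1+ε₀)^{2θk}` is monotone in `θ`);
* `kpPrimaryGraded_of_ceilingAt` — the composite.

HONEST FRAMING: bookkeeping about Tao-type MODEL lattice ODEs (route SubOnsagerCeiling, rung TL-M2Break); no stub,
crux or summit is proved and nothing here bears on Navier–Stokes regularity.
[cite: Tao2016AveragedNS, §4 (4.13)] [cite: BarbatoMorandinRomito2011, §3.2 (shape of the barrier)]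
-/

noncomputable section

-- the sub-problem namespace `NavierStokesRegularity.NavierStokesRegularity` is the tree's layout (D-0017)
set_option linter.dupNamespace false

namespace Summit.NavierStokesRegularity.NavierStokesRegularity.Theorems

open Set Finset
open Literature.Analysis.FluidPDE.TaoCascade
open Summit.NavierStokesRegularity.NavierStokesRegularity.Theorems.SubOnsagerCeiling

variable {α : Fin 4 → Fin 4 → Fin 4 → ℤ × ℤ × ℤ → ℝ}

/-- **Tail ceiling ⇒ shell barrier** (same `θ`, `D = C`): the window `N = n` of the tail sum is the shell sum
`Σ_i ½X_{i,n}(t)²`, each of whose (non-negative) terms is then `≤ C·E₀·(1+ε₀)^{-2θn}`.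
[cite: Tao2016AveragedNS, §4 (4.13)] -/
theorem kpShellBarrierAt_of_ceilingAt {R ε₀ : ℝ} (hε : 0 < ε₀) (h : CeilingAt R ε₀ α) :
    ShellBarrierAt R ε₀ α := by
  intro hT hO
  obtain ⟨θ, hθ, C, hC, H⟩ := h hT hO
  refine ⟨θ, hθ, C, hC, ?_⟩
  intro ν hν X₀ s hs X hX0 hXneg hM hXc hXd hXpos t ht i k
  have key := H ν hν X₀ s hs X hX0 hXneg hM hXc hXd hXpos k k le_rfl t ht
  rw [Finset.Icc_self, Finset.sum_singleton] at key
  have hsingle : (1 / 2 : ℝ) * X i (k : ℤ) t ^ 2 ≤ ∑ j : Fin 4, (1 / 2 : ℝ) * X j (k : ℤ) t ^ 2 :=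
    Finset.single_le_sum (f := fun j => (1 / 2 : ℝ) * X j (k : ℤ) t ^ 2) (fun j _ => by positivity)
      (Finset.mem_univ i)
  have hb : (0 : ℝ) < 1 + ε₀ := by linarith
  have hw : (0 : ℝ) < (1 + ε₀) ^ (2 * θ * (k : ℝ)) := Real.rpow_pos_of_pos hb _
  have hneg : (1 + ε₀) ^ (-(2 * θ * (k : ℝ))) = ((1 + ε₀) ^ (2 * θ * (k : ℝ)))⁻¹ := Real.rpow_neg hb.le _
  rw [hneg] at key
  calc (1 + ε₀) ^ (2 * θ * (k : ℝ)) * ((1 / 2 : ℝ) * X i (k : ℤ) t ^ 2)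
      ≤ (1 + ε₀) ^ (2 * θ * (k : ℝ)) * (C * (∑ j : Fin 4, (1 / 2 : ℝ) * X₀ j ^ 2) *
          ((1 + ε₀) ^ (2 * θ * (k : ℝ)))⁻¹) :=
        mul_le_mul_of_nonneg_left (hsingle.trans key) hw.le
    _ = C * (∑ j : Fin 4, (1 / 2 : ℝ) * X₀ j ^ 2) := by
        field_simp

/-- **Shell barrier ⇒ the primary graded barrier** (body of the skeleton's `PrimaryGradedAt R ε₀ α`, verbatim):
take the trivial grading `lev ≡ 0`, `L = 0` — the structural clauses only constrain modes of level `≠ 0`, so they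
hold vacuously — and the exponent `min θ 1 ∈ (1/2, 1]`, using `(1+ε₀)^{2(min θ 1)k} ≤ (1+ε₀)^{2θk}`.
So every landed `ShellBarrierAt` corner is a corner of the registered stubs. [cite: BarbatoMorandinRomito2011, §3.2] -/
theorem kpPrimaryGraded_of_shellBarrierAt {R ε₀ : ℝ} (hε : 0 < ε₀) (h : ShellBarrierAt R ε₀ α) :
    Literature.Analysis.FluidPDE.TaoCascade.InTableClass R α →
      (∀ (Y : Fin 4 → ℤ → ℝ → ℝ) (τ : ℝ), (∀ (j : Fin 4) (k : ℤ), 1 ≤ k → 0 ≤ Y j k τ) → ∀ δ : ℝ, 0 < δ →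
        ∀ (i : Fin 4) (n : ℤ), 1 ≤ n → Y i n τ = 0 → 0 ≤ Literature.Analysis.FluidPDE.TaoCascade.quadTerm δ α Y i n τ) →
      (∀ a b i : Fin 4, a ≠ b → α a b i (0, 0, 1) = 0) →
      ∃ (lev : Fin 4 → ℕ) (L : ℕ), (∀ a, lev a ≤ L) ∧
        (∀ a, lev a ≠ 0 → (∃ e, α a a e (0, 0, 1) ≠ 0) →
          (∀ j, α j j a (0, 0, 1) ≠ 0 → lev j < lev a ∧ (lev j = 0 ∨ ∃ e', α j j e' (0, 0, 1) ≠ 0)) ∧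
          (∀ i₁ i₂, i₁ ≠ a → i₂ ≠ a → α i₁ i₂ a (0, 0, 0) ≠ 0 →
            (lev i₁ < lev a ∧ (lev i₁ = 0 ∨ ∃ e', α i₁ i₁ e' (0, 0, 1) ≠ 0)) ∧
            (lev i₂ < lev a ∧ (lev i₂ = 0 ∨ ∃ e', α i₂ i₂ e' (0, 0, 1) ≠ 0))) ∧
          (∃ e, α a a e (0, 0, 1) ≠ 0 ∧
            (∀ j, α e e j (0, 0, 1) ≠ 0 → lev j < lev a ∧ (lev j = 0 ∨ ∃ e', α j j e' (0, 0, 1) ≠ 0)) ∧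
            (∀ j, j ≠ e → α e e j (0, 0, 0) ≠ 0 →
              lev j < lev a ∧ (lev j = 0 ∨ ∃ e', α j j e' (0, 0, 1) ≠ 0)))) ∧
        ∃ θ : ℝ, 1 / 2 < θ ∧ θ ≤ 1 ∧ ∃ D : ℝ, 0 ≤ D ∧
          ∀ ν : ℝ, 0 < ν → ∀ (X₀ : Fin 4 → ℝ) (s : ℝ), 0 < s → ∀ X : Fin 4 → ℤ → ℝ → ℝ,
          (∀ (i : Fin 4) (k : ℤ), X i k 0 = if k = 0 then X₀ i else 0) →
          (∀ (i : Fin 4) (k : ℤ), k < 0 → ∀ t : ℝ, X i k t = 0) →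
          (∃ M : ℝ, ∀ (t : ℝ) (i : Fin 4) (k : ℤ), (1 + (1 + ε₀) ^ ((10 : ℝ) * k)) * |X i k t| ≤ M) →
          (∀ (i : Fin 4) (k : ℤ), Continuous (X i k)) →
          (∀ (i : Fin 4) (k : ℤ), ∀ t ∈ Set.Icc (0 : ℝ) s, HasDerivWithinAt (X i k)
            (Literature.Analysis.FluidPDE.TaoCascade.quadTerm ε₀ α X i k t - ν * (1 + ε₀) ^ ((2 : ℝ) * k) * X i k t)
            (Set.Icc (0 : ℝ) s) t) →
          (∀ t ∈ Set.Icc (0 : ℝ) s, ∀ (i : Fin 4) (k : ℤ), 1 ≤ k → 0 ≤ X i k t) →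
          ∀ t ∈ Set.Icc (0 : ℝ) s, ∀ i, lev i = 0 → ∀ k : ℕ,
            (1 + ε₀) ^ (2 * θ * (k : ℝ)) * ((1 / 2 : ℝ) * X i (k : ℤ) t ^ 2) ≤
              D * (∑ j : Fin 4, (1 / 2 : ℝ) * X₀ j ^ 2) := by
  intro hT hO _hD
  obtain ⟨θ, hθ, D, hD, H⟩ := h hT hO
  refine ⟨fun _ => 0, 0, fun _ => le_rfl, fun a ha => absurd rfl ha, min θ 1,
    lt_min hθ (by norm_num), min_le_right θ 1, D, hD, ?_⟩
  intro ν hν X₀ s hs X hX0 hXneg hM hXc hXd hXpos t ht i _hi k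
  have key := H ν hν X₀ s hs X hX0 hXneg hM hXc hXd hXpos t ht i k
  have hb : (1 : ℝ) ≤ 1 + ε₀ := by linarith
  have hmono : (1 + ε₀) ^ (2 * min θ 1 * (k : ℝ)) ≤ (1 + ε₀) ^ (2 * θ * (k : ℝ)) :=
    Real.rpow_le_rpow_of_exponent_le hb
      (mul_le_mul_of_nonneg_right (by linarith [min_le_left θ 1]) (Nat.cast_nonneg k))
  exact (mul_le_mul_of_nonneg_right hmono (by positivity)).trans key

/-- **Tail ceiling ⇒ the primary graded barrier** (composite of the two lemmas above): every landed `CeilingAt`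
corner (uniform permutation / fan networks, the re-entry pairs, the side-branch classes, …) is a corner of the
registered stubs `stub_primaryGradedLargeRatio` / `stub_primaryGradedSmallRatio` themselves, not only of the
composition. [cite: Tao2016AveragedNS, §4 (4.13)] -/
theorem kpPrimaryGraded_of_ceilingAt {R ε₀ : ℝ} (hε : 0 < ε₀) (h : CeilingAt R ε₀ α) :
    Literature.Analysis.FluidPDE.TaoCascade.InTableClass R α →
      (∀ (Y : Fin 4 → ℤ → ℝ → ℝ) (τ : ℝ), (∀ (j : Fin 4) (k : ℤ), 1 ≤ k → 0 ≤ Y j k τ) → ∀ δ : ℝ, 0 < δ →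
        ∀ (i : Fin 4) (n : ℤ), 1 ≤ n → Y i n τ = 0 → 0 ≤ Literature.Analysis.FluidPDE.TaoCascade.quadTerm δ α Y i n τ) →
      (∀ a b i : Fin 4, a ≠ b → α a b i (0, 0, 1) = 0) →
      ∃ (lev : Fin 4 → ℕ) (L : ℕ), (∀ a, lev a ≤ L) ∧
        (∀ a, lev a ≠ 0 → (∃ e, α a a e (0, 0, 1) ≠ 0) →
          (∀ j, α j j a (0, 0, 1) ≠ 0 → lev j < lev a ∧ (lev j = 0 ∨ ∃ e', α j j e' (0, 0, 1) ≠ 0)) ∧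
          (∀ i₁ i₂, i₁ ≠ a → i₂ ≠ a → α i₁ i₂ a (0, 0, 0) ≠ 0 →
            (lev i₁ < lev a ∧ (lev i₁ = 0 ∨ ∃ e', α i₁ i₁ e' (0, 0, 1) ≠ 0)) ∧
            (lev i₂ < lev a ∧ (lev i₂ = 0 ∨ ∃ e', α i₂ i₂ e' (0, 0, 1) ≠ 0))) ∧
          (∃ e, α a a e (0, 0, 1) ≠ 0 ∧
            (∀ j, α e e j (0, 0, 1) ≠ 0 → lev j < lev a ∧ (lev j = 0 ∨ ∃ e', α j j e' (0, 0, 1) ≠ 0)) ∧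
            (∀ j, j ≠ e → α e e j (0, 0, 0) ≠ 0 →
              lev j < lev a ∧ (lev j = 0 ∨ ∃ e', α j j e' (0, 0, 1) ≠ 0)))) ∧
        ∃ θ : ℝ, 1 / 2 < θ ∧ θ ≤ 1 ∧ ∃ D : ℝ, 0 ≤ D ∧
          ∀ ν : ℝ, 0 < ν → ∀ (X₀ : Fin 4 → ℝ) (s : ℝ), 0 < s → ∀ X : Fin 4 → ℤ → ℝ → ℝ,
          (∀ (i : Fin 4) (k : ℤ), X i k 0 = if k = 0 then X₀ i else 0) →
          (∀ (i : Fin 4) (k : ℤ), k < 0 → ∀ t : ℝ, X i k t = 0) →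
          (∃ M : ℝ, ∀ (t : ℝ) (i : Fin 4) (k : ℤ), (1 + (1 + ε₀) ^ ((10 : ℝ) * k)) * |X i k t| ≤ M) →
          (∀ (i : Fin 4) (k : ℤ), Continuous (X i k)) →
          (∀ (i : Fin 4) (k : ℤ), ∀ t ∈ Set.Icc (0 : ℝ) s, HasDerivWithinAt (X i k)
            (Literature.Analysis.FluidPDE.TaoCascade.quadTerm ε₀ α X i k t - ν * (1 + ε₀) ^ ((2 : ℝ) * k) * X i k t)
            (Set.Icc (0 : ℝ) s) t) →
          (∀ t ∈ Set.Icc (0 : ℝ) s, ∀ (i : Fin 4) (k : ℤ), 1 ≤ k → 0 ≤ X i k t) →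
          ∀ t ∈ Set.Icc (0 : ℝ) s, ∀ i, lev i = 0 → ∀ k : ℕ,
            (1 + ε₀) ^ (2 * θ * (k : ℝ)) * ((1 / 2 : ℝ) * X i (k : ℤ) t ^ 2) ≤
              D * (∑ j : Fin 4, (1 / 2 : ℝ) * X₀ j ^ 2) :=
  kpPrimaryGraded_of_shellBarrierAt hε (kpShellBarrierAt_of_ceilingAt hε h)

end Summit.NavierStokesRegularity.NavierStokesRegularity.Theorems

end
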